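import Mathlib.Analysis.SpecialFunctions.Pow.Real
import Literature.Computability.Complexity.BoolEncodings
import Literature.Computability.Complexity.Promise
import HarnessLib

/-!
# Complexity meta: the Collective Minimum Monotone Satisfying Assignment problem (CMMSA)

Trunk `CplxMeta`; support for the NP-hardness of the partial-function Minimum Circuit Size
Problem `MCSP*` (`Literature.Computability.Complexity.isRandNPHard_MCSPStar`, `Literature/Computability/Complexity/
MCSPHardness.lean`; Hirahara, FOCS 2022, Thm. 1.2 / Thm. 8.5). Hirahara's proof factors through
a gap (promise) problem on collections of monotone DNF formulas, the *Collective Minimum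
(Weight) Monotone Satisfying Assignment* problem `CMMSA` (Hirahara 2022, Def. 5.1), which is
NP-hard under deterministic polynomial-time many-one reductions by a sliding-scale PCP theorem
(Dinur–Fischer–Kindler–Raz–Safra 2011; Dinur–Harsha–Kindler 2015) combined with the
Dinur–Safra reduction (Hirahara 2022, Thm. 5.2), and which then randomly reduces to `MCSP*`
(Hirahara 2022, Lemma 8.3 and the proof of Thm. 8.5). This file vendors

* `MonotoneDNF` — monotone DNF formulas over variables `ℕ` (a list of terms, each a list of
  variables read conjunctively), with `eval`, `numLiterals` (`|φ|`), `IsOver n`;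
* `CMMSAInstance` — instances `(Φ, w, s)` of Def. 5.1: the number `n` of variables, a
  collection `Φ = (φ₁, …, φ_m)` of monotone DNFs over `[n]`, a weight function `w : [n] → ℕ`
  (a list, encoded in *unary*), a threshold `s`; `weightOf` (`w(α) = Σᵢ α(i)·w(i)`), `satCount`
  (`#{j | φⱼ(α) = 1}`, so that `Pr_{φ∼Φ}[φ(α) = 1] = satCount/m`), `degree` (`max_φ |φ|`),
  `WellFormed`, and the Boolean `encoding`;
* `gapCMMSA g ε Δ : PromiseProblem` — CMMSA with gap `g(n)`, soundness `ε(n)` and degree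
  (at most) `Δ(n)` on collections of monotone DNFs over `n` variables (Def. 5.1 with the degree
  restriction of Thm. 5.2 made part of the promise);
* `sqrtLog n = ⌊√⌊log₂ n⌋⌋` — the parameter `Δ(n) = (log n)^{1/2}` at which Thm. 5.2 is used;
* the named fact `Hirahara2022_thm52_sqrtLog` — Thm. 5.2 at `Δ(n) = (log n)^{1/2}`:
  for some constant `α > 0`, `gapCMMSA (Δ^α) (Δ^{-α}) Δ` is NP-hard under polynomial-time
  many-one reductions (`PromiseProblem.IsNPHard`);
* API: `MonotoneDNF.eval_eq_true_iff`, `MonotoneDNF.eval_mono`, `CMMSAInstance.degree_le_iff`,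
  `gapCMMSA_disjoint`, `noSet_mono`/`IsHard.gapCMMSA_anti` (hardness is antitone in the gap and
  monotone in the soundness).

## Design choices

* Variables are natural numbers and assignments are `ℕ → Bool`; an instance records `n` and
  `WellFormed` asks that all variables occurring in `Φ` are `< n` and that the weight list has
  length `n` (`w i := weight[i]`, `0` out of range). The weight of an assignment only counts
  variables `< n` (Def. 5.1: `w(α) = Σ_{i=1}^{n} α(i)·w(i)`).
* `Φ` is a *list* (the paper's collection `{φ₁, …, φ_m}` is indexed by `j ∈ [m]`, and
  `Pr_{φ∼Φ}` is uniform over indices, proof of Thm. 5.2), so multiplicities count. The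
  probabilities of Def. 5.1 are cleared of denominators: Yes asks `satCount = m` in the form
  "every `φ ∈ Φ` is satisfied", No asks `satCount < ε(n) · m` (for `m = 0` no instance is a
  no-instance, and the yes/no parts are disjoint whenever `g ≥ 1`, `ε ≤ 1`, `gapCMMSA_disjoint`).
* Only monotone *DNF* collections are represented: Thm. 5.2 proves hardness already for DNF
  collections and Lemma 8.3 consumes arbitrary monotone formulas, so the DNF promise problem is
  the interface both sides of Hirahara's proof of Thm. 8.5 use. The degree bound `Δ(n)` of
  Thm. 5.2 ("degree `Δ(n)`") is part of the promise (both parts require `degree ≤ Δ(n)`).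
* Thm. 5.2 is printed for every `β > 0` and every parameter function `Δ` with
  `ω(1) ≤ Δ(n) ≤ 2^{(log n)^{1-β}}`; its proof lets the Karp reduction compute `Δ(n)` (to choose
  the PCP soundness `δ`), an implicit constructibility hypothesis. We therefore vendor the
  instance the paper itself uses (p. 16: "We will use this result for `Δ(n) := (log n)^{1/2}`";
  proof of Thm. 8.5), with the integer rounding `sqrtLog n = ⌊√⌊log₂ n⌋⌋` (any rounding changes
  `Δ` by at most `1`, absorbed in the unspecified constant `α`). Gap and soundness are the real
  functions `(sqrtLog n)^α` and `(sqrtLog n)^{-α}` (`Real.rpow`; for `n < 2`, `sqrtLog n = 0`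
  and the no-part is empty there — immaterial for hardness).
* Weights are encoded in unary (`unaryEncodingNat.listBool`), as in Def. 5.1 ("represented in
  unary"): the randomized reduction of Lemma 8.3 draws `w(k)·λ` random bits per variable and is
  polynomial-time only in the unary size. `n`, variables and the threshold are binary
  (`encodingNatBool`); collections are nested `listBool` codes.
* Mathlib has no monotone-formula minimisation problems, PCPs or gap problems of this kind
  (searched `Monotone`, `DNF`, `MMSA`, `SatisfyingAssignment`); `PromiseProblem`,
  `PromiseProblem.IsNPHard`, `Encoding.pairBool/listBool` are G01's (`Promise.lean`,
  `BoolEncodings.lean`).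

## References

* S. Hirahara, *NP-hardness of learning programs and partial MCSP*, FOCS 2022, pp. 968–979;
  full version ECCC TR22-119 (numbering used here): Def. 5.1 (p. 15), Thm. 5.2 and its proof
  (pp. 16–18), Lemma 5.3 (p. 16), Lemma 8.3 (p. 26), Thm. 8.5 (p. 30).
* I. Dinur, S. Safra, *On the hardness of approximating label-cover*, IPL 89 (2004)
  (MMSA; the reduction reused in Thm. 5.2).
* I. Dinur, E. Fischer, G. Kindler, R. Raz, S. Safra, *PCP characterizations of NP: toward a
  polynomially-small error-probability*, Comput. Complexity 20 (2011); I. Dinur, P. Harsha,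
  G. Kindler, *Polynomially low error PCPs with polyloglog n queries via modular composition*,
  STOC 2015 (the sliding-scale PCP, Hirahara's Lemma 5.3).
* M. Alekhnovich, S. Buss, S. Moran, T. Pitassi, *Minimum propositional proof length is NP-hard
  to linearly approximate*, JSL 66 (2001) (the original MMSA problem).
-/

namespace Literature.Computability.MetaComplexity

open _root_.Computability Complexity

/-! ### Monotone DNF formulas -/

/-- A *monotone DNF formula* over the variables `ℕ`: a list of terms, each term a list of
variables read as the conjunction of these (positive) literals; the formula is the disjunction
of its terms. (Hirahara 2022, §5: "a collection `Φ` of monotone DNF formulas over `n`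
variables"; e.g. the formulas `ϕⱼ = ⋁_{r} ⋀_{x ∈ dom r} L_{x,r(x)}` of the proof of Thm. 5.2.)
[cite: Hirahara2022PartialMCSP, §5 (Thm. 5.2 and its proof)] -/
abbrev MonotoneDNF : Type := List (List ℕ)

namespace MonotoneDNF

/-- The value of a monotone DNF under an assignment `a : ℕ → Bool`: some term has all its
variables set to `true`. [cite: Hirahara2022PartialMCSP, §5 (Def. 5.1, `ϕ(α)`)] -/
def eval (φ : MonotoneDNF) (a : ℕ → Bool) : Bool :=
  φ.any fun t => t.all a

/-- The number `|φ|` of literals of a monotone DNF (with multiplicity: the sum of the term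
lengths); the *degree* of a collection is the maximum of these (Hirahara 2022, Def. 5.1:
"`|ϕ|` denotes the number of the literals in the formula `ϕ`"). [cite: Hirahara2022PartialMCSP, Def. 5.1] -/
def numLiterals (φ : MonotoneDNF) : ℕ :=
  (φ.map List.length).sum

/-- `φ.IsOver n`: every variable occurring in `φ` is `< n` (a formula "over the set `[n]` of
input variables", Def. 5.1). [cite: Hirahara2022PartialMCSP, Def. 5.1] -/
def IsOver (n : ℕ) (φ : MonotoneDNF) : Prop :=
  ∀ t ∈ φ, ∀ i ∈ t, i < n

/-- A monotone DNF is true iff some term has all its variables true. [cite: Hirahara2022PartialMCSP, Def. 5.1] -/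
theorem eval_eq_true_iff (φ : MonotoneDNF) (a : ℕ → Bool) :
    φ.eval a = true ↔ ∃ t ∈ φ, ∀ i ∈ t, a i = true := by
  simp [eval, List.any_eq_true, List.all_eq_true]

/-- The empty DNF (no terms) is identically false. [folklore] -/
@[simp] theorem eval_nil (a : ℕ → Bool) : eval [] a = false := rfl

/-- A DNF containing the empty term is identically true. [folklore] -/
theorem eval_eq_true_of_nil_mem {φ : MonotoneDNF} (h : [] ∈ φ) (a : ℕ → Bool) :
    φ.eval a = true :=
  (eval_eq_true_iff φ a).2 ⟨[], h, fun _ hi => by simp at hi⟩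

/-- **Monotonicity**: raising variables from `false` to `true` keeps a monotone DNF true (the
access structures of §4.2 are monotone for this reason). [cite: Hirahara2022PartialMCSP, Def. 4.3 and Def. 5.1] -/
theorem eval_mono {φ : MonotoneDNF} {a b : ℕ → Bool} (hab : ∀ i, a i = true → b i = true)
    (h : φ.eval a = true) : φ.eval b = true := by
  rw [eval_eq_true_iff] at h ⊢
  obtain ⟨t, ht, hta⟩ := h
  exact ⟨t, ht, fun i hi => hab i (hta i hi)⟩

/-- The literal count of the empty DNF is `0`. [folklore] -/
@[simp] theorem numLiterals_nil : numLiterals [] = 0 := rfl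

/-- The literal count is additive over terms. [folklore] -/
@[simp] theorem numLiterals_cons (t : List ℕ) (φ : MonotoneDNF) :
    numLiterals (t :: φ) = t.length + numLiterals φ := by
  simp [numLiterals]

end MonotoneDNF

/-! ### CMMSA instances -/

/-- An instance `(Φ, w, s)` of the Collective Minimum (Weight) Monotone Satisfying Assignment
problem (Hirahara 2022, Def. 5.1): the number `numVars = n` of input variables, a collection
`formulas = Φ = (φ₁, …, φ_m)` of monotone DNF formulas over `[n]`, the weight function
`w : [n] → ℕ` as the list `weight` (represented in unary in the encoding), and the threshold
parameter `threshold = s`. Well-formedness (variables `< n`, `|weight| = n`) is the predicate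
`WellFormed`, imposed by the promise problem. [cite: Hirahara2022PartialMCSP, Def. 5.1] -/
structure CMMSAInstance where
  /-- The number `n` of input variables (the size measure of Def. 5.1). -/
  numVars : ℕ
  /-- The collection `Φ = (φ₁, …, φ_m)` of monotone DNF formulas. -/
  formulas : List MonotoneDNF
  /-- The weight function `w : [n] → ℕ`, `w i = weight[i]`. -/
  weight : List ℕ
  /-- The threshold parameter `s`. -/
  threshold : ℕ

namespace CMMSAInstance

/-- The weight `w(i)` of the variable `i` (`0` if `i` is out of range). [cite: Hirahara2022PartialMCSP, Def. 5.1] -/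
def w (I : CMMSAInstance) (i : ℕ) : ℕ :=
  I.weight.getD i 0

/-- The weight of an assignment with respect to `w`: `w(α) = Σ_{i < n} α(i) · w(i)`
(Hirahara 2022, §5, before Def. 5.1). [cite: Hirahara2022PartialMCSP, §5 (weight of an assignment)] -/
def weightOf (I : CMMSAInstance) (a : ℕ → Bool) : ℕ :=
  ∑ i ∈ Finset.range I.numVars, if a i then I.w i else 0

/-- The number of formulas of the collection satisfied by `α`, `#{j ∈ [m] | φⱼ(α) = 1}`, so
that `Pr_{φ∼Φ}[φ(α) = 1] = satCount / m`. [cite: Hirahara2022PartialMCSP, Def. 5.1] -/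
def satCount (I : CMMSAInstance) (a : ℕ → Bool) : ℕ :=
  I.formulas.countP fun φ => φ.eval a

/-- The number `m` of formulas in the collection. [cite: Hirahara2022PartialMCSP, Def. 5.1] -/
def numFormulas (I : CMMSAInstance) : ℕ :=
  I.formulas.length

/-- The degree of the collection: `max_{φ ∈ Φ} |φ|` (`0` for the empty collection).
[cite: Hirahara2022PartialMCSP, Def. 5.1 ("The degree of Φ")] -/
def degree (I : CMMSAInstance) : ℕ :=
  (I.formulas.map MonotoneDNF.numLiterals).foldr max 0

/-- Well-formed instances: the weight list has length `n` and every formula is over `[n]`.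
[cite: Hirahara2022PartialMCSP, Def. 5.1] -/
def WellFormed (I : CMMSAInstance) : Prop :=
  I.weight.length = I.numVars ∧ ∀ φ ∈ I.formulas, φ.IsOver I.numVars

/-- `degree ≤ d` iff every formula of the collection has at most `d` literals (the degree is
the maximum literal count). [cite: Hirahara2022PartialMCSP, Def. 5.1] -/
theorem degree_le_iff (I : CMMSAInstance) (d : ℕ) :
    I.degree ≤ d ↔ ∀ φ ∈ I.formulas, φ.numLiterals ≤ d := by
  unfold degree
  induction I.formulas with
  | nil => simp
  | cons φ l ih =>
    simp only [List.map_cons, List.foldr_cons, max_le_iff, List.mem_cons, forall_eq_or_imp]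
    exact and_congr Iff.rfl ih

/-- `satCount` is at most the number of formulas. [cite: Hirahara2022PartialMCSP, Def. 5.1] -/
theorem satCount_le_numFormulas (I : CMMSAInstance) (a : ℕ → Bool) :
    I.satCount a ≤ I.numFormulas :=
  List.countP_le_length

/-- All formulas are satisfied by `α` iff `satCount α = m` (i.e. `Pr_{φ∼Φ}[φ(α) = 1] = 1`).
[cite: Hirahara2022PartialMCSP, Def. 5.1 (Yes case)] -/
theorem satCount_eq_numFormulas_iff (I : CMMSAInstance) (a : ℕ → Bool) :
    I.satCount a = I.numFormulas ↔ ∀ φ ∈ I.formulas, φ.eval a = true := by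
  simp [satCount, numFormulas, List.countP_eq_length]

/-! ### Boolean encoding of instances -/

/-- The instance as the tuple `(n, Φ, w, s)`. [folklore] -/
def toTuple (I : CMMSAInstance) : ℕ × List (List (List ℕ)) × List ℕ × ℕ :=
  (I.numVars, I.formulas, I.weight, I.threshold)

/-- The instance with tuple `(n, Φ, w, s)`. [folklore] -/
def ofTuple (t : ℕ × List (List (List ℕ)) × List ℕ × ℕ) : CMMSAInstance :=
  ⟨t.1, t.2.1, t.2.2.1, t.2.2.2⟩

/-- `ofTuple` inverts `toTuple`. [folklore] -/
@[simp] theorem ofTuple_toTuple (I : CMMSAInstance) : ofTuple I.toTuple = I := by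
  cases I
  rfl

/-- `toTuple` inverts `ofTuple`. [folklore] -/
@[simp] theorem toTuple_ofTuple (t : ℕ × List (List (List ℕ)) × List ℕ × ℕ) :
    (ofTuple t).toTuple = t := rfl

/-- The Boolean encoding of the tuple `(n, Φ, w, s)`: `n`, variables and `s` in binary
(`encodingNatBool`), the collection as nested `listBool` codes, and the weights **in unary**
(`unaryEncodingNat.listBool`; Def. 5.1: "the weight function … represented in unary").
[cite: Hirahara2022PartialMCSP, Def. 5.1] -/
def tupleEncoding : Encoding (ℕ × List (List (List ℕ)) × List ℕ × ℕ) Bool :=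
  encodingNatBool.pairBool
    ((encodingNatBool.listBool.listBool.listBool).pairBool
      (unaryEncodingNat.listBool.pairBool encodingNatBool))

/-- The Boolean encoding of CMMSA instances (through `toTuple`/`ofTuple` and `tupleEncoding`).
[cite: Hirahara2022PartialMCSP, Def. 5.1] -/
def encoding : Encoding CMMSAInstance Bool where
  encode I := tupleEncoding.encode I.toTuple
  decode v := (tupleEncoding.decode v).map ofTuple
  decode_encode I := by simp [tupleEncoding.decode_encode]

/-- The encoding of an instance is the tuple code of `(n, Φ, w, s)` (definitional). [folklore] -/
theorem encoding_encode (I : CMMSAInstance) :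
    encoding.encode I = tupleEncoding.encode I.toTuple := rfl

end CMMSAInstance

/-! ### The promise problem `CMMSA` with gap, soundness and degree -/

namespace CMMSA

/-- Yes-instances of CMMSA with degree bound `Δ` (Def. 5.1, Yes, with the degree restriction
of Thm. 5.2): well-formed instances of degree `≤ Δ(n)` admitting an assignment `α` with
`w(α) ≤ s` satisfying every formula of `Φ` (`Pr_{φ∼Φ}[φ(α) = 1] = 1`).
[cite: Hirahara2022PartialMCSP, Def. 5.1 (Yes) and Thm. 5.2] -/
def yesSet (Δ : ℕ → ℕ) : Set CMMSAInstance :=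
  {I | I.WellFormed ∧ I.degree ≤ Δ I.numVars ∧
    ∃ a : ℕ → Bool, I.weightOf a ≤ I.threshold ∧ ∀ φ ∈ I.formulas, φ.eval a = true}

/-- No-instances of CMMSA with gap `g`, soundness `ε` and degree bound `Δ` (Def. 5.1, No, with
the degree restriction of Thm. 5.2): well-formed instances of degree `≤ Δ(n)` such that every
assignment `α` with `w(α) ≤ g(n) · s` satisfies fewer than an `ε(n)`-fraction of the formulas,
`#{j | φⱼ(α) = 1} < ε(n) · m`. [cite: Hirahara2022PartialMCSP, Def. 5.1 (No) and Thm. 5.2] -/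
def noSet (g ε : ℕ → ℝ) (Δ : ℕ → ℕ) : Set CMMSAInstance :=
  {I | I.WellFormed ∧ I.degree ≤ Δ I.numVars ∧
    ∀ a : ℕ → Bool, (I.weightOf a : ℝ) ≤ g I.numVars * I.threshold →
      (I.satCount a : ℝ) < ε I.numVars * I.numFormulas}

/-- The no-part shrinks when the gap grows and the soundness decreases: for `g ≤ g'` and
`ε' ≤ ε` pointwise, `noSet g' ε' Δ ⊆ noSet g ε Δ`. [cite: Hirahara2022PartialMCSP, Def. 5.1] -/
theorem noSet_mono {g g' ε ε' : ℕ → ℝ} {Δ : ℕ → ℕ} (hg : ∀ n, g n ≤ g' n)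
    (hε : ∀ n, ε' n ≤ ε n) : noSet g' ε' Δ ⊆ noSet g ε Δ := by
  rintro I ⟨hwf, hdeg, hno⟩
  refine ⟨hwf, hdeg, fun a ha => ?_⟩
  have ha' : (I.weightOf a : ℝ) ≤ g' I.numVars * I.threshold :=
    ha.trans (mul_le_mul_of_nonneg_right (hg _) (Nat.cast_nonneg _))
  exact (hno a ha').trans_le (mul_le_mul_of_nonneg_right (hε _) (Nat.cast_nonneg _))

/-- For gap `g ≥ 1` and soundness `ε ≤ 1` the yes- and no-instances are disjoint: a satisfying
assignment of weight `≤ s ≤ g · s` satisfies all `m ≥ ε · m` formulas.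
[cite: Hirahara2022PartialMCSP, Def. 5.1] -/
theorem disjoint_yesSet_noSet {g ε : ℕ → ℝ} {Δ : ℕ → ℕ} (hg : ∀ n, 1 ≤ g n)
    (hε : ∀ n, ε n ≤ 1) : Disjoint (yesSet Δ) (noSet g ε Δ) := by
  refine Set.disjoint_left.2 ?_
  rintro I ⟨-, -, a, ha, hall⟩ ⟨-, -, hno⟩
  have hw : (I.weightOf a : ℝ) ≤ g I.numVars * I.threshold := by
    calc (I.weightOf a : ℝ) ≤ I.threshold := by exact_mod_cast ha
      _ = 1 * (I.threshold : ℝ) := (one_mul _).symm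
      _ ≤ g I.numVars * I.threshold := mul_le_mul_of_nonneg_right (hg _) (Nat.cast_nonneg _)
  have hlt := hno a hw
  have hsat : (I.satCount a : ℝ) = I.numFormulas := by
    exact_mod_cast (I.satCount_eq_numFormulas_iff a).2 hall
  rw [hsat] at hlt
  have hm : (ε I.numVars) * I.numFormulas ≤ 1 * (I.numFormulas : ℝ) :=
    mul_le_mul_of_nonneg_right (hε _) (Nat.cast_nonneg _)
  rw [one_mul] at hm
  exact absurd (hlt.trans_le hm) (lt_irrefl _)

end CMMSA

/-- The promise problem **CMMSA with gap `g`, soundness `ε` and degree `Δ`** over `{0,1}`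
(Hirahara 2022, Def. 5.1 with the degree restriction of Thm. 5.2): yes-instances are the codes of
`CMMSA.yesSet Δ`, no-instances the codes of `CMMSA.noSet g ε Δ`, under
`CMMSAInstance.encoding`. The size measure `n` of Def. 5.1 is the field `numVars`, at which the
parameter functions are evaluated. [cite: Hirahara2022PartialMCSP, Def. 5.1 and Thm. 5.2] -/
def gapCMMSA (g ε : ℕ → ℝ) (Δ : ℕ → ℕ) : PromiseProblem :=
  PromiseProblem.ofEncoding CMMSAInstance.encoding (CMMSA.yesSet Δ) (CMMSA.noSet g ε Δ)

/-- The yes-part of `gapCMMSA g ε Δ` is the language of `CMMSA.yesSet Δ` (definitional).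
[cite: Hirahara2022PartialMCSP, Def. 5.1] -/
@[simp] theorem gapCMMSA_yes (g ε : ℕ → ℝ) (Δ : ℕ → ℕ) :
    (gapCMMSA g ε Δ).yes = CMMSAInstance.encoding.toLanguage (CMMSA.yesSet Δ) := rfl

/-- The no-part of `gapCMMSA g ε Δ` is the language of `CMMSA.noSet g ε Δ` (definitional).
[cite: Hirahara2022PartialMCSP, Def. 5.1] -/
@[simp] theorem gapCMMSA_no (g ε : ℕ → ℝ) (Δ : ℕ → ℕ) :
    (gapCMMSA g ε Δ).no = CMMSAInstance.encoding.toLanguage (CMMSA.noSet g ε Δ) := rfl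

/-- For `g ≥ 1` and `ε ≤ 1`, `gapCMMSA g ε Δ` is a genuine (disjoint) promise problem.
[cite: Hirahara2022PartialMCSP, Def. 5.1] -/
theorem gapCMMSA_disjoint {g ε : ℕ → ℝ} {Δ : ℕ → ℕ} (hg : ∀ n, 1 ≤ g n)
    (hε : ∀ n, ε n ≤ 1) : (gapCMMSA g ε Δ).Disjoint :=
  PromiseProblem.disjoint_ofEncoding _ (CMMSA.disjoint_yesSet_noSet hg hε)

/-- **Hardness is antitone in the gap and monotone in the soundness.** A Karp reduction into
`gapCMMSA g' ε' Δ` is one into `gapCMMSA g ε Δ` whenever `g ≤ g'` and `ε' ≤ ε` (same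
yes-part, smaller no-part, `CMMSA.noSet_mono`). [cite: Hirahara2022PartialMCSP, Def. 5.1; Goldreich2006, Def. 1.4] -/
theorem _root_.Literature.Computability.Complexity.PromiseProblem.IsHard.gapCMMSA_anti {C : Set (Language Bool)}
    {g g' ε ε' : ℕ → ℝ} {Δ : ℕ → ℕ} (h : (gapCMMSA g' ε' Δ).IsHard C)
    (hg : ∀ n, g n ≤ g' n) (hε : ∀ n, ε' n ≤ ε n) : (gapCMMSA g ε Δ).IsHard C := by
  intro L hL
  obtain ⟨f, hf, hy, hn⟩ := h L hL
  refine ⟨f, hf, hy, fun x hx => ?_⟩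
  exact Encoding.toLanguage_mono _ (CMMSA.noSet_mono hg hε) (hn hx)

/-! ### Hirahara's Theorem 5.2 at `Δ(n) = (log n)^{1/2}` -/

/-- The degree parameter `Δ(n) = (log n)^{1/2}` at which Hirahara uses Thm. 5.2 (p. 16 and the
proof of Thm. 8.5), rounded to a natural number: `sqrtLog n = ⌊√⌊log₂ n⌋⌋` (`Nat.sqrt`,
`Nat.log 2`). [cite: Hirahara2022PartialMCSP, §5 (after Thm. 5.2) and proof of Thm. 8.5] -/
def sqrtLog (n : ℕ) : ℕ :=
  Nat.sqrt (Nat.log 2 n)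

/-- `sqrtLog` unfolds to `Nat.sqrt (Nat.log 2 n)` (definitional). [folklore] -/
theorem sqrtLog_def (n : ℕ) : sqrtLog n = Nat.sqrt (Nat.log 2 n) := rfl

/-- `sqrtLog` is monotone. [folklore] -/
theorem sqrtLog_mono : Monotone sqrtLog :=
  fun _ _ h => Nat.sqrt_le_sqrt (Nat.log_mono_right h)

/-- `sqrtLog` is unbounded: `sqrtLog (2 ^ (k ^ 2)) = k` (so `ω(1) ≤ Δ(n)`, as Thm. 5.2
requires). [folklore] -/
theorem sqrtLog_two_pow_sq (k : ℕ) : sqrtLog (2 ^ (k ^ 2)) = k := by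
  rw [sqrtLog, Nat.log_pow (by norm_num), Nat.pow_two, Nat.sqrt_eq]

/-- **Hirahara 2022, Thm. 5.2 at `Δ(n) = (log n)^{1/2}`** (NP-hardness of CMMSA; from the
sliding-scale PCP of Dinur–Fischer–Kindler–Raz–Safra 2011 / Dinur–Harsha–Kindler 2015,
Lemma 5.3, and the Dinur–Safra reduction). Thm. 5.2 as printed: for every constant `β > 0`
there is a constant `α > 0` such that for every parameter `Δ : ℕ → ℕ` with
`ω(1) ≤ Δ(n) ≤ 2^{(log n)^{1-β}}` for all large `n`, it is NP-hard under polynomial-time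
many-one reductions to compute CMMSA with gap `Δ(n)^α`, degree `Δ(n)` and soundness
`Δ(n)^{-α}` on collections of monotone DNF formulas over `n` variables. Vendored at the
parameter the paper uses, `Δ(n) = (log n)^{1/2}` (which satisfies the range condition, e.g.
with `β = 1/2`), rounded as `sqrtLog`: there is `α > 0` such that the promise problem
`gapCMMSA (n ↦ Δ(n)^α) (n ↦ Δ(n)^{-α}) Δ`, `Δ = sqrtLog`, is NP-hard under deterministic
polynomial-time Karp reductions of promise problems (`PromiseProblem.IsNPHard`, Goldreich 2006,
Def. 1.4). [cite: Hirahara2022PartialMCSP, Thm. 5.2 (with Lemma 5.3) at Δ(n) = (log n)^{1/2}, p. 16] -/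
def Hirahara2022_thm52_sqrtLog : Prop :=
  ∃ α : ℝ, 0 < α ∧
    (gapCMMSA (fun n => (sqrtLog n : ℝ) ^ α) (fun n => (sqrtLog n : ℝ) ^ (-α)) sqrtLog).IsNPHard

end Literature.Computability.MetaComplexity
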